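import Literature.MathematicalPhysics.QuantumFieldTheory.Balaban1983to89.B11Eq98W80ModulusLetterDefects
import Literature.MathematicalPhysics.QuantumFieldTheory.Balaban1983to89.B11Eq98V0CurrentBackgroundModulus

/-!
# `Balaban1983to89.B11Eq98W80ModulusV0Discharged` — T. Bałaban, *The variational problem and background fields in renormalization group method for lattice gauge theories*, Commun. Math. Phys. **102** (1985) 277–309 [Balaban1985Variational]: Prop. 4 (97)–(98) pp. 292–293, Sect. C (44)–(52) p. 285, Prop. 6 (117)–(121) p. 295, (90)/(92) pp. 291–292, with [Balaban1985BackgroundPropagators] (3.1)–(3.5) pp. 390–391, Thm 3.4 p. 400 — THE BACKGROUND MODULUS OF `W = (δ/δA′)V` ACROSS TWO CARRIERS MODULO THE LETTER DEFECTS `δ_H`, `δ_C`, `δ_Δ` ONLY: the V₀-group's `δ_V` DISCHARGED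

statement-level skeleton of published theorems with citation tags; proofs where landed; nothing here is a claim about the Yang–Mills mass gap

PDF held: `paper:balaban1985-cmp102-variational-background` (journal page = PDF page + 276); pp. 285, 290–295 read on the text layer by this lineage.

CITATION HEADER (lean-in-tree rule 2026-08-18).  WHAT IS REPRODUCED: nothing of print is asserted.  This is the junction of two landed pieces of this lineage:
`B11Eq98W80ModulusLetterDefects.exists_W80_background_modulus_of_letter_defects` (the W80 background modulus across two (115) carriers modulo the
letter defects `δ_H` of `H`, `δ_C` of `C`, `δ_Δ` of `Δ_π` and the V₀-group's background modulus `δ_V`) and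
`B11Eq98V0CurrentBackgroundModulus.curV0_background_modulus_two_carriers` (the `δ_V` binder supplied: `δ_V := K_V·R_V²·δ` for unit-ball backgrounds with
`‖U₁(b) − U₂(b)‖ ≤ δ`, `K_V = 524288·e⁴(d − 1)Λ²L^{j_M}‖ρ‖‖τ‖`).

WHAT IS PROVED (sorry-free; axioms standard; 0 def).  **`exists_W80_background_modulus_HCDelta`** — `exists_W80_background_modulus_of_letter_defects` with its
`hδV`/`δ_V` binders REPLACED by: unit-ball bond variables at both backgrounds, `0 ≤ δ`, `‖U₁(b) − U₂(b)‖ ≤ δ`, `1 ≤ L`, the level-geometry display `Λ` of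
`B11Eq90V0primeCurrent.norm_curV0prime_le`, the top level `j(b) ≤ j_M`, and `R_V ≤ 1/16`; conclusion
`‖W80(…₁)(P) − W80(…₂)(ιP)‖₍₋₃₎ ≤ K·((δ_T-expression in δ_H, δ_C) + (δ_Q-expression in δ_H, δ_C) + δ_Δ + 524288·e⁴(d − 1)Λ²L^{j_M}M_ρM_τ·R_V²·δ)` on `‖P‖ < r`
under the two radius caps of `exists_W80_background_modulus`, `K` chosen BEFORE the carriers and all operator letters.

HONEST SCOPE — what is NOT claimed.  (i) `δ_H, δ_C, δ_Δ` stay DISPLAYED (their producers are the OWNER's / leaf-04's two-background series and the `Δ_π`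
instancer; `δ_Δ` is `0`-able by `Δ_π₂ := Δ_π₁ ∘ ι⁻¹`).  (ii) The `δ` term carries the CRUDE fixed-lattice constant of `B11Eq98V0CurrentBackgroundModulus`
(`∝ L^{j_M}`; (38) unused, (39) not summed by parts) — the generality of the consumer `Support/NE9CurChartLipschitzAtFlat`, NOT print's uniformity.
(iii) Nothing of Prop. 4, (98), Prop. 6, Thm 3.4 is proved; NOT summit progress (cell pub-balaban: NE9 NOT PRINTED / NOT PROVED; «NE9 ⇐ the named
binders»; spine PROVED 0/9; HONEST DEPENDENCY: continuum YM on T⁴ ⇐ BetaPertH ∧ nine spine estimates (0/9 proved); BetaPertH ⇐ (D1) ∧ (D4) ∧ CAP+tail;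
G-an2-4 gates asym, D1 and NE2/3/4).  Unit `b2b-balaban-t4-ne9-formalise-leaf-05` (NE9 crux-team leaf prover, gen 71).  Imports the two files named ONLY;
modifies nothing.
-/

noncomputable section

open Metric Set

namespace Literature.MathematicalPhysics.QuantumFieldTheory.Balaban1983to89.B11Eq98W80ModulusV0Discharged

open Literature.MathematicalPhysics.QuantumFieldTheory.Balaban1983to89.B11Prop6Scheme (Prop4Hyp)
open Literature.MathematicalPhysics.QuantumFieldTheory.Balaban1983to89.B11Eq174Chart (Regime)
open Literature.MathematicalPhysics.QuantumFieldTheory.Balaban1983to89.B11Eq63V0GroupCurrent (curV0)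
open Literature.MathematicalPhysics.QuantumFieldTheory.Balaban1983to89.B11Eq80Current (W80)
open Literature.MathematicalPhysics.QuantumFieldTheory.Balaban1983to89.B11Eq111FrakG (jetLinearEquiv)
open Literature.MathematicalPhysics.QuantumFieldTheory.Balaban1983to89.B9Eq39Adjoint (posPlaq)
open Literature.MathematicalPhysics.QuantumFieldTheory.Balaban1983to89.B11Eq90StB (st)
open Literature.MathematicalPhysics.QuantumFieldTheory.Balaban1983to89.B11Eq90V0primeBond (plaqWeight)
open Literature.MathematicalPhysics.QuantumFieldTheory.Balaban1983to89.B11Eq90V0primeCurrent (Tsh)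
open Literature.MathematicalPhysics.QuantumFieldTheory.Balaban1983to89.B11Eq98W80ModulusLetterDefects (exists_W80_background_modulus_of_letter_defects)
open Literature.MathematicalPhysics.QuantumFieldTheory.Balaban1983to89.B11Eq98V0CurrentBackgroundModulus (curV0_background_modulus_two_carriers)
open B9SectCLatticeCarrier (Bond)
open B4Sect5Torus (TSite)
open B11Eq115Space

variable {𝔸 : Type*} [NormedRing 𝔸] [NormedAlgebra ℂ 𝔸] [FiniteDimensional ℂ 𝔸]
variable {d : ℕ} {Pd : Fin d → ℕ} {L η : ℝ} [Fact (0 < L)] [Fact (0 < η)] {lev₀ : Bond d Pd → ℕ} {κ' : Type*} [Fintype κ']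
  {lev₁ : κ' → ℕ}
variable {𝒳 : Type*} [NormedAddCommGroup 𝒳] [NormedSpace ℂ 𝒳]

/-- **THE W80 BACKGROUND MODULUS MODULO `δ_H, δ_C, δ_Δ` ONLY — `δ_V` DISCHARGED**: `exists_W80_background_modulus_of_letter_defects` with the V₀-group's
background modulus supplied by `B11Eq98V0CurrentBackgroundModulus.curV0_background_modulus_two_carriers` at `δ_V := 524288·e⁴(d − 1)Λ²L^{j_M}‖ρ‖‖τ‖·R_V²·δ`
(then `‖ρ‖ ≤ M_ρ`, `‖τ‖ ≤ M_τ`), for bond variables of both backgrounds in the unit balls with `‖U₁(b) − U₂(b)‖ ≤ δ`, `0 ≤ δ`, `R_V ≤ 1/16`, the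
level-geometry display `Λ` and the top level `j_M`. [folklore]
[cite: Balaban1985Variational, Prop. 4 (97)–(98) pp.292–293, (90) p.291, (47)–(52) p.285, Prop. 6 (117)–(121) p.295; Balaban1985BackgroundPropagators, (3.1)–(3.5) pp.390–391, Thm 3.4 p.400] -/
theorem exists_W80_background_modulus_HCDelta [CompleteSpace 𝒳] [CompleteSpace 𝔸] {b C₂ c₄ aC εC CV RV Mρ Mτ MJ MΔ MD Kι Λ : ℝ} {jM : ℕ}
    (haC : 0 < aC) (hεC : 0 ≤ εC) (hcontr : 4 * b * C₂ * (εC + aC) < 1) (hCV : 0 ≤ CV) (hRV : 0 < RV) (hRV' : RV ≤ 1 / 16)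
    (hMρ : 0 ≤ Mρ) (hMτ : 0 ≤ Mτ) (hMJ : 0 ≤ MJ) (hMΔ : 0 ≤ MΔ) (hMD : 0 ≤ MD) (hKι : 1 ≤ Kι) (hL : 1 ≤ L)
    (hΛ : ∀ q ∈ posPlaq (TSite d Pd) (Fin d), ∀ (μ₀ : Fin d) (x₀ : TSite d Pd), q ∈ st Tsh μ₀ x₀ →
      levWeight L η lev₀ 1 (x₀, μ₀) ≤ Λ * plaqWeight Tsh (levWeight L η lev₀ 1) q)
    (hlev : ∀ b, lev₀ b ≤ jM) :
    ∃ K : ℝ, 0 < K ∧ ∀ {r : ℝ}, r ≤ aC / (2 * Kι ^ 2) → r ≤ RV / (4 * Kι * (1 / (1 - 4 * b * C₂ * (εC + aC)))) →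
      ∀ {Dc₁ Dc₂ : (Bond d Pd → 𝔸) →ₗ[ℂ] (κ' → 𝔸)}, (∀ g : Bond d Pd → 𝔸, ‖Dc₂ g‖ ≤ MD * ‖g‖) →
      (∀ P : Space115 L η lev₀ lev₁ Dc₁, ‖(LinearMap.toContinuousLinearMap ((jetLinearEquiv L η lev₀ lev₁ Dc₂).symm.toLinearMap ∘ₗ (jetLinearEquiv L η lev₀ lev₁ Dc₁).toLinearMap)) P‖ ≤ Kι * ‖P‖) → (∀ Q : Space115 L η lev₀ lev₁ Dc₂, ‖(LinearMap.toContinuousLinearMap ((jetLinearEquiv L η lev₀ lev₁ Dc₁).symm.toLinearMap ∘ₗ (jetLinearEquiv L η lev₀ lev₁ Dc₂).toLinearMap)) Q‖ ≤ Kι * ‖Q‖) →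
      ∀ {H₁ : 𝒳 →L[ℂ] Space115 L η lev₀ lev₁ Dc₁} {C₁ : Space115 L η lev₀ lev₁ Dc₁ → 𝒳}
        {H₂ : 𝒳 →L[ℂ] Space115 L η lev₀ lev₁ Dc₂} {C₂' : Space115 L η lev₀ lev₁ Dc₂ → 𝒳},
        Regime H₁ 0 C₁ b 0 C₂ c₄ 0 aC εC → Prop4Hyp C₁ C₂ c₄ → Regime H₂ 0 C₂' b 0 C₂ c₄ 0 aC εC → Prop4Hyp C₂' C₂ c₄ →
      ∀ (ρ : (𝔸 →L[ℂ] ℂ) →L[ℂ] 𝔸) (τ : 𝔸 →L[ℂ] ℂ) (U₁ U₂ : Bond d Pd → 𝔸ˣ), ‖ρ‖ ≤ Mρ → ‖τ‖ ≤ Mτ →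
        (∀ b, ‖(U₁ b : 𝔸)‖ ≤ 1 ∧ ‖(((U₁ b)⁻¹ : 𝔸ˣ) : 𝔸)‖ ≤ 1) → (∀ b, ‖(U₂ b : 𝔸)‖ ≤ 1 ∧ ‖(((U₂ b)⁻¹ : 𝔸ˣ) : 𝔸)‖ ≤ 1) →
      ∀ {δ : ℝ}, 0 ≤ δ → (∀ b, ‖(U₁ b : 𝔸) - (U₂ b : 𝔸)‖ ≤ δ) →
        (∀ Y : Space115 L η lev₀ lev₁ Dc₁, ‖Y‖ < RV → ‖curV0 (lev₁ := lev₁) (Dc := Dc₁) ρ τ U₁ Y‖ ≤ CV * ‖Y‖ ^ 2) →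
        (∀ Y : Space115 L η lev₀ lev₁ Dc₂, ‖Y‖ < RV → ‖curV0 (lev₁ := lev₁) (Dc := Dc₂) ρ τ U₂ Y‖ ≤ CV * ‖Y‖ ^ 2) →
      ∀ (J : NegSize L η lev₀ 3 𝔸) (Δπ₁ : Space115 L η lev₀ lev₁ Dc₁ →L[ℂ] NegSize L η lev₀ 3 𝔸)
        (Δπ₂ : Space115 L η lev₀ lev₁ Dc₂ →L[ℂ] NegSize L η lev₀ 3 𝔸), ‖J‖ ≤ MJ → ‖Δπ₁‖ ≤ MΔ → ‖Δπ₂‖ ≤ MΔ →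
      ∀ {ρC sC : ℝ}, Kι * (εC + aC) ≤ ρC → 0 < sC → 2 * (ρC + sC) ≤ c₄ → 4 * b * C₂ * (ρC + sC) < 1 →
      ∀ {δH δC δΔ : ℝ}, 0 ≤ δH → 0 ≤ δC → 0 ≤ δΔ →
        (∀ B : 𝒳, ‖(LinearMap.toContinuousLinearMap ((jetLinearEquiv L η lev₀ lev₁ Dc₂).symm.toLinearMap ∘ₗ (jetLinearEquiv L η lev₀ lev₁ Dc₁).toLinearMap)) (H₁ B) - H₂ B‖ ≤ δH * ‖B‖) →
        (∀ y : Space115 L η lev₀ lev₁ Dc₁, ‖y‖ < εC + aC → ‖C₁ y - C₂' ((LinearMap.toContinuousLinearMap ((jetLinearEquiv L η lev₀ lev₁ Dc₂).symm.toLinearMap ∘ₗ (jetLinearEquiv L η lev₀ lev₁ Dc₁).toLinearMap)) y)‖ ≤ δC) →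
        (∀ Y : Space115 L η lev₀ lev₁ Dc₁, ‖Δπ₁ Y - Δπ₂ ((LinearMap.toContinuousLinearMap ((jetLinearEquiv L η lev₀ lev₁ Dc₂).symm.toLinearMap ∘ₗ (jetLinearEquiv L η lev₀ lev₁ Dc₁).toLinearMap)) Y)‖ ≤ δΔ * ‖Y‖) →
      ∀ P : Space115 L η lev₀ lev₁ Dc₁, ‖P‖ < r →
        ‖W80 ρ τ U₁ H₁ C₁ εC J Δπ₁ P - W80 ρ τ U₂ H₂ C₂' εC J Δπ₂ ((LinearMap.toContinuousLinearMap ((jetLinearEquiv L η lev₀ lev₁ Dc₂).symm.toLinearMap ∘ₗ (jetLinearEquiv L η lev₀ lev₁ Dc₁).toLinearMap)) P)‖ ≤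
          K * ((δH * (C₂ * (εC + aC) ^ 2) + b * δC) / (1 - 4 * b * C₂ * (ρC + sC)) +
            (8 * C₂ * δH + 8 * b * δC / (εC + aC) ^ 2) * aC ^ 2 + δΔ
            + (524288 * Real.exp 4 * ((d - 1 : ℕ) : ℝ) * Λ ^ 2 * L ^ jM * Mρ * Mτ * RV ^ 2) * δ) := by
  obtain ⟨K, hK, HW⟩ := exists_W80_background_modulus_of_letter_defects (d := d) (Pd := Pd) (L := L) (η := η) (lev₀ := lev₀) (κ' := κ')
    (lev₁ := lev₁) (𝒳 := 𝒳) (𝔸 := 𝔸) haC hεC hcontr hCV hRV hMρ hMτ hMJ hMΔ hMD hKι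
  refine ⟨K, hK, ?_⟩
  intro r hra hrV Dc₁ Dc₂ hD₂ hι hκι H₁ C₁ H₂ C₂' RC₁ hC₁ RC₂ hC₂ ρ τ U₁ U₂ hρ hτ hUn₁ hUn₂ δ hδ0 hδ hqV₁ hqV₂ J Δπ₁ Δπ₂ hJ hΔ₁ hΔ₂ ρC sC
    hρ₁ hsC hdomC hκC δH δC δΔ hδH hδC hδΔ hdH hdC hmΔ P hP
  have hL0 : 0 < L := Fact.out
  -- the V₀-group's background modulus, supplied
  have hmV := curV0_background_modulus_two_carriers (lev₁ := lev₁) (Dc₁ := Dc₁) (Dc₂ := Dc₂) ρ τ U₁ U₂ hUn₁ hUn₂ hδ0 hδ hL hΛ hlev hRV hRV'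
  have hδV0 : 0 ≤ (524288 * Real.exp 4 * ((d - 1 : ℕ) : ℝ) * Λ ^ 2 * L ^ jM * ‖ρ‖ * ‖τ‖ * RV ^ 2) * δ := by positivity
  have h := HW hra hrV hD₂ hι hκι RC₁ hC₁ RC₂ hC₂ ρ τ U₁ U₂ hρ hτ hqV₁ hqV₂ J Δπ₁ Δπ₂ hJ hΔ₁ hΔ₂ hρ₁ hsC hdomC hκC hδH hδC hδΔ hδV0 hdH hdC hmΔ
    hmV P hP
  refine h.trans (mul_le_mul_of_nonneg_left ?_ hK.le)
  have hmono : (524288 * Real.exp 4 * ((d - 1 : ℕ) : ℝ) * Λ ^ 2 * L ^ jM * ‖ρ‖ * ‖τ‖ * RV ^ 2) * δ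
      ≤ (524288 * Real.exp 4 * ((d - 1 : ℕ) : ℝ) * Λ ^ 2 * L ^ jM * Mρ * Mτ * RV ^ 2) * δ := by
    have h0 : 0 ≤ 524288 * Real.exp 4 * ((d - 1 : ℕ) : ℝ) * Λ ^ 2 * L ^ jM := by positivity
    have h1 : ‖ρ‖ * ‖τ‖ ≤ Mρ * Mτ := mul_le_mul hρ hτ (norm_nonneg _) hMρ
    calc (524288 * Real.exp 4 * ((d - 1 : ℕ) : ℝ) * Λ ^ 2 * L ^ jM * ‖ρ‖ * ‖τ‖ * RV ^ 2) * δ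
        = (524288 * Real.exp 4 * ((d - 1 : ℕ) : ℝ) * Λ ^ 2 * L ^ jM) * (‖ρ‖ * ‖τ‖) * (RV ^ 2 * δ) := by ring
      _ ≤ (524288 * Real.exp 4 * ((d - 1 : ℕ) : ℝ) * Λ ^ 2 * L ^ jM) * (Mρ * Mτ) * (RV ^ 2 * δ) := by gcongr
      _ = _ := by ring
  linarith

end Literature.MathematicalPhysics.QuantumFieldTheory.Balaban1983to89.B11Eq98W80ModulusV0Discharged

end
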